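import Summits.CriticalPhenomena.CardyFormulaZ2.Theorems.CardyBoundaryCoulombGasRectilinearCardyStubKernelPointAsymptoticsPart1
import HarnessLib

/-!
# Stub `stub_kernelPointAsymptotics` of line `excursion-kernel-covariance`, part 2: the point limit
# along a sequence of meshes (crux `RectilinearCardy`, stmt-CriticalPhenomena-5660, route `CardyBoundaryCoulombGas`)

The sequential heart of the uniform point asymptotics of the cube-root weight
`rowWeight R δ v = (G_δ(v,p⁰_δ) G_δ(v,p¹_δ) G_δ(v,p³_δ))^{1/3}` (`G_δ = dirichletGreen (closureFinset R δ)`,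
`pⁱ_δ = markRow R δ i`) of a rectilinear conformal rectangle `R = (Ω; a, b, c, d)` with flat marks and a
conformal bijection `w : Ω → ℍ` holomorphic on an open `U ⊇ Ω ∪ {a, b, d}`:

* `kpa_pole_limit` — the tree's PROVED Chelkak–Smirnov Thm 3.13 fact
  `ChelkakSmirnov2011_boundaryNormalisedPoissonKernelLimit_holds`, instantiated on the closure
  discretisation `V_n = closureFinset R δ_n` with normalisation point `a_n → x` (flat, `x ∈ U`) on the
  boundary row, pole `pⁱ_{δ_n} → pt i` and interior evaluation point `c_n = nearestSite δ_n u₀ → u₀ ∈ Ω`: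
  `G(c_n, pⁱ) δ_n / G(a_n, pⁱ) → Lᵢ = Im w(u₀)/|w(u₀) − w(pt i)|² · |w(x) − w(pt i)|²/|w′(x)|`, together with
  `Im w(pt i) = 0` and `w′(x) ≠ 0` (the tree's `flat_point_expansion`);
* `kpa_seq_limit` — inverting the three limits (`Lᵢ > 0`), multiplying and taking cube roots:
  `rowWeight R δ_n a_n / (δ_n Π_n^{1/3}) → |w′(x)| (∏ᵢ |w(x) − w(pt i)|²)^{-1/3}` with the reference
  product `Π_n = ∏ᵢ G(c_n, pⁱ) |w(u₀) − w(pt i)|²/Im w(u₀)`, eventually positive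
  (`kpa_ratio_identity`, `kpa_limit_identity` are the two pieces of real algebra).

[cite: ChelkakSmirnov2011, Thm. 3.13] for the fact; everything else [folklore].
-/

noncomputable section

open Set Filter Topology Metric
open Literature.Probability.RandomPlanarGeometry
open Literature.Probability.LatticeModels (Site meshPoint meshVertices meshVertices_finite dirichletGreen
  zdGraph nearestSite dist_meshPoint_nearestSite_le Orient exists_orient_of_flat flat_point_expansion
  ChelkakSmirnov2011_boundaryNormalisedPoissonKernelLimit_holds)
open Summit.CriticalPhenomena.CardyFormulaZ2.Theorems.RectilinearCardy.Negative (IsRectilinear)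

namespace Summit.CriticalPhenomena.CardyFormulaZ2.Cruxes.RectilinearCardy.ExcursionKernelCovariance

/-! ### Real algebra of the cube-root weight -/

/-- A positive quotient `h d / g` of non-negative reals `h, g` has positive numerator factor `h` and
positive denominator (Lean's `x / 0 = 0`). [folklore] -/
theorem kpa_pos_of_div_pos {h g d : ℝ} (hh : 0 ≤ h) (hg : 0 ≤ g) (hpos : 0 < h * d / g) :
    0 < g ∧ 0 < h := by
  have hg' : 0 < g := lt_of_le_of_ne hg fun h0 => by
    rw [← h0, div_zero] at hpos
    exact lt_irrefl _ hpos
  refine ⟨hg', ?_⟩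
  have h1 : 0 < h * d := (div_pos_iff_of_pos_right hg').1 hpos
  rcases hh.lt_or_eq with h2 | h2
  · exact h2
  · rw [← h2, zero_mul] at h1
    exact absurd h1 (lt_irrefl _)

/-- **The renormalised cube-root weight through the three normalised kernels** (exact lattice
identity, all quantities positive):
`(g₀g₁g₃)^{1/3}/(δ (h₀A₀ h₁A₁ h₃A₃)^{1/3}) = (∏ᵢ (hᵢδ/gᵢ · Aᵢ)⁻¹)^{1/3}`. [folklore] -/
theorem kpa_ratio_identity {g₀ g₁ g₃ h₀ h₁ h₃ A₀ A₁ A₃ δ : ℝ} (hg₀ : 0 < g₀) (hg₁ : 0 < g₁) (hg₃ : 0 < g₃)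
    (hh₀ : 0 < h₀) (hh₁ : 0 < h₁) (hh₃ : 0 < h₃) (hA₀ : 0 < A₀) (hA₁ : 0 < A₁) (hA₃ : 0 < A₃)
    (hδ : 0 < δ) :
    (g₀ * g₁ * g₃) ^ (1 / 3 : ℝ) / (δ * (h₀ * A₀ * (h₁ * A₁) * (h₃ * A₃)) ^ (1 / 3 : ℝ)) =
      ((h₀ * δ / g₀ * A₀)⁻¹ * (h₁ * δ / g₁ * A₁)⁻¹ * (h₃ * δ / g₃ * A₃)⁻¹) ^ (1 / 3 : ℝ) := by
  have heq : (h₀ * δ / g₀ * A₀)⁻¹ * (h₁ * δ / g₁ * A₁)⁻¹ * (h₃ * δ / g₃ * A₃)⁻¹ =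
      g₀ * g₁ * g₃ / (δ ^ 3 * (h₀ * A₀ * (h₁ * A₁) * (h₃ * A₃))) := by
    field_simp
  have hP : (0 : ℝ) ≤ h₀ * A₀ * (h₁ * A₁) * (h₃ * A₃) := by positivity
  -- `(δ³)^{1/3} = δ` (the tree's `JelliumBoseGas.pow_three_rpow_third`, two lines, not worth the import)
  have h3 : (δ ^ 3) ^ (1 / 3 : ℝ) = δ := by
    rw [← Real.rpow_natCast, ← Real.rpow_mul hδ.le]
    norm_num
  rw [heq, Real.div_rpow (by positivity : (0 : ℝ) ≤ g₀ * g₁ * g₃)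
      (by positivity : (0 : ℝ) ≤ δ ^ 3 * (h₀ * A₀ * (h₁ * A₁) * (h₃ * A₃))),
    Real.mul_rpow (pow_nonneg hδ.le 3) hP, h3]

/-- **The value of the limit**: with `Lᵢ = I/Bᵢ · Xᵢ/d` and `Aᵢ = Bᵢ/I`,
`(∏ᵢ (Lᵢ Aᵢ)⁻¹)^{1/3} = d · (X₀X₁X₃)^{-1/3}`. [folklore] -/
theorem kpa_limit_identity {I B₀ B₁ B₃ X₀ X₁ X₃ d : ℝ} (hI : 0 < I) (hB₀ : 0 < B₀) (hB₁ : 0 < B₁)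
    (hB₃ : 0 < B₃) (hX₀ : 0 < X₀) (hX₁ : 0 < X₁) (hX₃ : 0 < X₃) (hd : 0 < d) :
    ((I / B₀ * (X₀ / d) * (B₀ / I))⁻¹ * (I / B₁ * (X₁ / d) * (B₁ / I))⁻¹ *
        (I / B₃ * (X₃ / d) * (B₃ / I))⁻¹) ^ (1 / 3 : ℝ) = d * (X₀ * X₁ * X₃) ^ (-(1 / 3 : ℝ)) := by
  have heq : (I / B₀ * (X₀ / d) * (B₀ / I))⁻¹ * (I / B₁ * (X₁ / d) * (B₁ / I))⁻¹ *
      (I / B₃ * (X₃ / d) * (B₃ / I))⁻¹ = d ^ 3 / (X₀ * X₁ * X₃) := by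
    field_simp
  have h3 : (d ^ 3) ^ (1 / 3 : ℝ) = d := by
    rw [← Real.rpow_natCast, ← Real.rpow_mul hd.le]
    norm_num
  rw [heq, Real.div_rpow (by positivity) (by positivity), h3, Real.rpow_neg (by positivity),
    div_eq_mul_inv]

/-! ### The cited fact at one pole -/

/-- **The normalised kernel limit at one pole** (Chelkak–Smirnov 2011, Thm 3.13, the tree's PROVED
fact `ChelkakSmirnov2011_boundaryNormalisedPoissonKernelLimit_holds`, instantiated). For the
rectilinear conformal rectangle `R` with flat marks, `w : Ω → ℍ` a conformal bijection holomorphic on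
an open `U ⊇ Ω`, a flat boundary point `x ∈ U` with `w x ≠ w (pt i)` (`pt i ∈ U`), meshes
`δ_n → 0⁺`, boundary-row vertices `a_n` of `V_n = closureFinset R δ_n` with `δ_n a_n → x`, good pole
representatives and reference sites: `Im w(pt i) = 0`, `w′(x) ≠ 0`, and
`G(c_n, pⁱ_n) δ_n / G(a_n, pⁱ_n) → Im w(u₀)/|w u₀ − w(pt i)|² · |w x − w(pt i)|²/|w′ x|`.
[cite: ChelkakSmirnov2011, Thm. 3.13] -/
theorem kpa_pole_limit (R : ConformalRectangle) (hRect : IsRectilinear R)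
    (hfl : ∀ i : Fin 4, ∃ r : ℝ, 0 < r ∧ FlatNear R (R.pt i) r)
    {U : Set ℂ} {w : ℂ → ℂ} (hU : IsOpen U) (hRU : R.carrier ⊆ U)
    (hw : DifferentiableOn ℂ w U) (hbij : BijOn w R.carrier {z : ℂ | 0 < z.im})
    {u₀ : ℂ} (hu₀ : u₀ ∈ R.carrier)
    {x : ℂ} (hx : x ∈ frontier R.carrier) (hxU : x ∈ U) (hxfl : ∃ r : ℝ, 0 < r ∧ FlatNear R x r)
    {δ : ℕ → ℝ} (hδ : ∀ n, 0 < δ n) (hδ0 : Tendsto δ atTop (𝓝 0))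
    {a : ℕ → Site 2} (ha : ∀ n, a n ∈ boundaryRow R (δ n))
    (hax : Tendsto (fun n => meshPoint (δ n) (a n)) atTop (𝓝 x))
    (hm : ∀ n (i : Fin 4), markRow R (δ n) i ∈ boundaryRow R (δ n) ∧
      dist (meshPoint (δ n) (markRow R (δ n) i)) (R.pt i) < 2 * δ n)
    (hc : ∀ n, nearestSite (δ n) u₀ ∈ closureFinset R (δ n))
    (i : Fin 4) (hiU : R.pt i ∈ U) (hxi : w x ≠ w (R.pt i)) :
    (w (R.pt i)).im = 0 ∧ deriv w x ≠ 0 ∧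
      Tendsto (fun n => dirichletGreen (closureFinset R (δ n)) (nearestSite (δ n) u₀) (markRow R (δ n) i) *
          δ n / dirichletGreen (closureFinset R (δ n)) (a n) (markRow R (δ n) i)) atTop
        (𝓝 ((w u₀).im / ‖w u₀ - w (R.pt i)‖ ^ 2 * (‖w x - w (R.pt i)‖ ^ 2 / ‖deriv w x‖))) := by
  have hxy : x ≠ R.pt i := fun h => hxi (by rw [h])
  obtain ⟨r, hr, hxfl'⟩ := hxfl
  obtain ⟨o, hsx, hsx'⟩ := exists_orient_of_flat R.toJordanDomain hx hr hxfl'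
  have hfp := flat_point_expansion R.toJordanDomain hx (R.pt_mem_frontier i) hxy o hr hsx hsx' hU hRU
    hxU hiU hw hbij
  refine ⟨hfp.1, hfp.2.2.1, ?_⟩
  exact ChelkakSmirnov2011_boundaryNormalisedPoissonKernelLimit_holds R.toJordanDomain hRect x (R.pt i)
    hx (R.pt_mem_frontier i) hxy ⟨r, hr, hxfl'⟩ (hfl i) w U hU hRU hxU hiU hw hbij δ hδ hδ0
    (fun n => closureFinset R (δ n)) (fun n v => mem_closureFinset_iff R (hδ n)) a
    (fun n => markRow R (δ n) i) (fun n => (mem_boundaryRow_iff R).1 (ha n))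
    (fun n => (mem_boundaryRow_iff R).1 (hm n i).1) hax
    (kpa_tendsto_meshPoint_markRow R hδ0 i fun n => (hm n i).2) u₀ hu₀ (fun n => nearestSite (δ n) u₀) hc
    (kpa_tendsto_meshPoint_nearestSite hδ hδ0 u₀)

/-! ### The point limit along a sequence of meshes -/

/-- **The cube-root weight at boundary-row vertices converging to a flat boundary point.** In the
setting of `kpa_pole_limit` with `w x ≠ w (pt i)` for `i = 0, 1, 3` (`a, b, d ∈ U`): the reference product
`Π_n = ∏_{i=0,1,3} G(c_n, pⁱ_n) |w u₀ − w(pt i)|²/Im w(u₀)` is eventually positive and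
`rowWeight R δ_n a_n / (δ_n Π_n^{1/3}) → |w′ x| · (∏_{i=0,1,3} |w x − w(pt i)|²)^{-1/3}`.
Proof: the three limits of `kpa_pole_limit` are positive, so eventually all six Green functions are
positive and the renormalised weight is `(∏ᵢ (Tᵢ(n) Aᵢ)⁻¹)^{1/3}` (`kpa_ratio_identity`), a continuous
function of the three normalised kernels `Tᵢ(n) → Lᵢ`; its value at the limit is the claim
(`kpa_limit_identity`). [folklore] -/
theorem kpa_seq_limit (R : ConformalRectangle) (hRect : IsRectilinear R)
    (hfl : ∀ i : Fin 4, ∃ r : ℝ, 0 < r ∧ FlatNear R (R.pt i) r)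
    {U : Set ℂ} {w : ℂ → ℂ} (hU : IsOpen U) (hRU : R.carrier ⊆ U)
    (h0U : R.pt 0 ∈ U) (h1U : R.pt 1 ∈ U) (h3U : R.pt 3 ∈ U)
    (hw : DifferentiableOn ℂ w U) (hbij : BijOn w R.carrier {z : ℂ | 0 < z.im})
    {u₀ : ℂ} (hu₀ : u₀ ∈ R.carrier)
    {x : ℂ} (hx : x ∈ frontier R.carrier) (hxU : x ∈ U) (hxfl : ∃ r : ℝ, 0 < r ∧ FlatNear R x r)
    (hx0 : w x ≠ w (R.pt 0)) (hx1 : w x ≠ w (R.pt 1)) (hx3 : w x ≠ w (R.pt 3))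
    {δ : ℕ → ℝ} (hδ : ∀ n, 0 < δ n) (hδ0 : Tendsto δ atTop (𝓝 0))
    {a : ℕ → Site 2} (ha : ∀ n, a n ∈ boundaryRow R (δ n))
    (hax : Tendsto (fun n => meshPoint (δ n) (a n)) atTop (𝓝 x))
    (hm : ∀ n (i : Fin 4), markRow R (δ n) i ∈ boundaryRow R (δ n) ∧
      dist (meshPoint (δ n) (markRow R (δ n) i)) (R.pt i) < 2 * δ n)
    (hc : ∀ n, nearestSite (δ n) u₀ ∈ closureFinset R (δ n)) :
    (∀ᶠ n in atTop, 0 <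
      dirichletGreen (closureFinset R (δ n)) (nearestSite (δ n) u₀) (markRow R (δ n) 0) *
          (‖w u₀ - w (R.pt 0)‖ ^ 2 / (w u₀).im) *
        (dirichletGreen (closureFinset R (δ n)) (nearestSite (δ n) u₀) (markRow R (δ n) 1) *
          (‖w u₀ - w (R.pt 1)‖ ^ 2 / (w u₀).im)) *
        (dirichletGreen (closureFinset R (δ n)) (nearestSite (δ n) u₀) (markRow R (δ n) 3) *
          (‖w u₀ - w (R.pt 3)‖ ^ 2 / (w u₀).im))) ∧
    Tendsto (fun n => rowWeight R (δ n) (a n) / (δ n *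
      (dirichletGreen (closureFinset R (δ n)) (nearestSite (δ n) u₀) (markRow R (δ n) 0) *
          (‖w u₀ - w (R.pt 0)‖ ^ 2 / (w u₀).im) *
        (dirichletGreen (closureFinset R (δ n)) (nearestSite (δ n) u₀) (markRow R (δ n) 1) *
          (‖w u₀ - w (R.pt 1)‖ ^ 2 / (w u₀).im)) *
        (dirichletGreen (closureFinset R (δ n)) (nearestSite (δ n) u₀) (markRow R (δ n) 3) *
          (‖w u₀ - w (R.pt 3)‖ ^ 2 / (w u₀).im))) ^ (1 / 3 : ℝ))) atTop
      (𝓝 (‖deriv w x‖ * (‖w x - w (R.pt 0)‖ ^ 2 * ‖w x - w (R.pt 1)‖ ^ 2 *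
        ‖w x - w (R.pt 3)‖ ^ 2) ^ (-(1 / 3 : ℝ)))) := by
  -- the three normalised kernel limits
  obtain ⟨him0, hd, hT0⟩ := kpa_pole_limit R hRect hfl hU hRU hw hbij hu₀ hx hxU hxfl hδ hδ0 ha hax hm hc
    0 h0U hx0
  obtain ⟨him1, -, hT1⟩ := kpa_pole_limit R hRect hfl hU hRU hw hbij hu₀ hx hxU hxfl hδ hδ0 ha hax hm hc
    1 h1U hx1
  obtain ⟨him3, -, hT3⟩ := kpa_pole_limit R hRect hfl hU hRU hw hbij hu₀ hx hxU hxfl hδ hδ0 ha hax hm hc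
    3 h3U hx3
  -- positivity of the constants
  have hI : 0 < (w u₀).im := hbij.mapsTo hu₀
  have hB : ∀ i : Fin 4, (w (R.pt i)).im = 0 → 0 < ‖w u₀ - w (R.pt i)‖ ^ 2 := by
    intro i hi
    have hne : w u₀ - w (R.pt i) ≠ 0 := fun h => by
      have h' := congrArg Complex.im h
      rw [Complex.sub_im, hi, sub_zero, Complex.zero_im] at h'
      exact hI.ne' h'
    have := norm_pos_iff.2 hne
    positivity
  have hB0 := hB 0 him0
  have hB1 := hB 1 him1
  have hB3 := hB 3 him3
  have hX : ∀ i : Fin 4, w x ≠ w (R.pt i) → 0 < ‖w x - w (R.pt i)‖ ^ 2 := by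
    intro i hi
    have := norm_pos_iff.2 (sub_ne_zero.2 hi)
    positivity
  have hX0 := hX 0 hx0
  have hX1 := hX 1 hx1
  have hX3 := hX 3 hx3
  have hdpos : 0 < ‖deriv w x‖ := norm_pos_iff.2 hd
  have hA0 : 0 < ‖w u₀ - w (R.pt 0)‖ ^ 2 / (w u₀).im := div_pos hB0 hI
  have hA1 : 0 < ‖w u₀ - w (R.pt 1)‖ ^ 2 / (w u₀).im := div_pos hB1 hI
  have hA3 : 0 < ‖w u₀ - w (R.pt 3)‖ ^ 2 / (w u₀).im := div_pos hB3 hI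
  have hL0 : 0 < (w u₀).im / ‖w u₀ - w (R.pt 0)‖ ^ 2 * (‖w x - w (R.pt 0)‖ ^ 2 / ‖deriv w x‖) := by
    positivity
  have hL1 : 0 < (w u₀).im / ‖w u₀ - w (R.pt 1)‖ ^ 2 * (‖w x - w (R.pt 1)‖ ^ 2 / ‖deriv w x‖) := by
    positivity
  have hL3 : 0 < (w u₀).im / ‖w u₀ - w (R.pt 3)‖ ^ 2 * (‖w x - w (R.pt 3)‖ ^ 2 / ‖deriv w x‖) := by
    positivity
  -- eventually all six Green functions are positive
  have hG0 : ∀ n (p q : Site 2), 0 ≤ dirichletGreen (closureFinset R (δ n)) p q := fun n p q =>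
    Literature.Probability.LatticeModels.dirichletGreen_nonneg (by norm_num) _ _ _
  have key : ∀ᶠ n in atTop,
      (0 < dirichletGreen (closureFinset R (δ n)) (a n) (markRow R (δ n) 0) ∧
        0 < dirichletGreen (closureFinset R (δ n)) (nearestSite (δ n) u₀) (markRow R (δ n) 0)) ∧
      (0 < dirichletGreen (closureFinset R (δ n)) (a n) (markRow R (δ n) 1) ∧
        0 < dirichletGreen (closureFinset R (δ n)) (nearestSite (δ n) u₀) (markRow R (δ n) 1)) ∧
      (0 < dirichletGreen (closureFinset R (δ n)) (a n) (markRow R (δ n) 3) ∧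
        0 < dirichletGreen (closureFinset R (δ n)) (nearestSite (δ n) u₀) (markRow R (δ n) 3)) := by
    filter_upwards [hT0.eventually (lt_mem_nhds hL0), hT1.eventually (lt_mem_nhds hL1),
      hT3.eventually (lt_mem_nhds hL3)] with n hn0 hn1 hn3
    exact ⟨kpa_pos_of_div_pos (hG0 n _ _) (hG0 n _ _) hn0, kpa_pos_of_div_pos (hG0 n _ _) (hG0 n _ _) hn1,
      kpa_pos_of_div_pos (hG0 n _ _) (hG0 n _ _) hn3⟩
  refine ⟨?_, ?_⟩
  · filter_upwards [key] with n hn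
    have h0 := hn.1.2
    have h1 := hn.2.1.2
    have h3 := hn.2.2.2
    positivity
  · -- the renormalised weight as a continuous function of the three normalised kernels
    have hF := ((((hT0.mul_const (‖w u₀ - w (R.pt 0)‖ ^ 2 / (w u₀).im)).inv₀ (by positivity)).mul
      ((hT1.mul_const (‖w u₀ - w (R.pt 1)‖ ^ 2 / (w u₀).im)).inv₀ (by positivity))).mul
      ((hT3.mul_const (‖w u₀ - w (R.pt 3)‖ ^ 2 / (w u₀).im)).inv₀ (by positivity))).rpow_const
      (p := (1 / 3 : ℝ)) (Or.inr (by norm_num))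
    rw [kpa_limit_identity hI hB0 hB1 hB3 hX0 hX1 hX3 hdpos] at hF
    refine hF.congr' ?_
    filter_upwards [key] with n hn
    simp only [rowWeight]
    exact (kpa_ratio_identity hn.1.1 hn.2.1.1 hn.2.2.1 hn.1.2 hn.2.1.2 hn.2.2.2 hA0 hA1 hA3 (hδ n)).symm

end Summit.CriticalPhenomena.CardyFormulaZ2.Cruxes.RectilinearCardy.ExcursionKernelCovariance

end
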